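import Summits.KontsevichZagierPeriods.KontsevichZagierPeriods.Theorems.HurwitzMicroSectorsHurwitzSectorComplementStubPartialFractions
import Literature.NumberTheory.Transcendental.KZSemialgebraicComplex
import Literature.NumberTheory.Transcendental.SemialgebraicLineDeriv
import Literature.NumberTheory.Transcendental.BoxIntegralHurwitz

/-!
# Crux `HurwitzSectorComplement` (stmt-KontsevichZagierPeriods-14341), line
# `chebyshev-level-deformation`: stub `towerReduction_kernelPoly`

For `N ≥ 1`, `0 ≤ 2a ≤ N`, `θ = 2πa/N` and a real algebraic twist `α`, the two cyclotomic
Chebyshev kernels are level-`N` sector integrands with real-algebraic coefficients: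

* `α (cos θ − t)/(1 − 2t cos θ + t²) = R_T(t)/(1 − t^N)` on `[0,1)` with
  `R_T = α Σ_{r<N} cos((r+1)θ) X^r`, symmetric (`R_i = R_j` for `i + j + 2 = N`);
* `α √(1 − cos²θ)/(1 − 2t cos θ + t²) = R_U(t)/(1 − t^N)` on `[0,1)` with
  `R_U = α Σ_{r<N} sin((r+1)θ) X^r`, antisymmetric, `R_{N−1} = α sin(2πa) = 0`;

and both kernels, composed with `t = ∏ xᵢ`, are `ℚ`-semialgebraic and integrable on the open
unit box of every dimension `n + 2`.

Proof: the Chebyshev generating functions `Σ tⁿ cos((n+1)θ) = (cos θ − t)/(1 − 2t cos θ + t²)`,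
`Σ tⁿ sin((n+1)θ) = sin θ/(1 − 2t cos θ + t²)` (tree: `PartialFractions.hasSum_cos_sin_geom`)
have `N`-periodic coefficients at `θ = 2πa/N`, so they resum over residue classes
(`Σ_{n ≡ r (N)} tⁿ = t^r/(1 − t^N)`) to `(Σ_{r<N} c_r t^r)/(1 − t^N)`. The coefficients
`cos((r+1)θ)`, `sin((r+1)θ)` are algebraic (tree: `PairValueAlgebraic.isAlgebraic_cos_two_pi_mul`,
`…sin…`); `√(1 − cos²θ) = sin θ` as `θ ∈ [0, π]`. Semialgebraicity: arithmetic closure of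
`ℚ`-semialgebraic functions and `ℚ`-definability of real algebraic constants
(`isSemialgebraicFunOn_const_of_isAlgebraic`); integrability: the resummed form is a finite
combination of the Hurwitz kernels `t^r/(1 − t^N)`
(`BoxIntegral.integrableOn_box_prod_pow_div_one_sub_prod_pow`). No new definitions; helpers live
in the sub-namespace `TowerReductionKernelPoly`. [folklore]
-/

noncomputable section

open Set MeasureTheory
open scoped BigOperators
open Literature.NumberTheory.Transcendental
open Real

namespace Summit.KontsevichZagierPeriods.Theorems.HurwitzMicroSectorsHurwitzSectorComplement

namespace TowerReductionKernelPoly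

/-! ### Step 1: resummation of periodic power series over residue classes -/

-- adapted from `PartialFractions.hasSum_ite_mul_pow` (sibling file `…StubPartialFractions.lean`)
/-- `Σ_{n ≥ 0, n ≡ r (N)} tⁿ = t^r/(1 − t^N)` for `r < N`, `0 ≤ t < 1` (reindex `n = Nk + r`,
geometric series in `t^N`). [folklore] -/
theorem hasSum_ite_mod {N r : ℕ} (hN : 0 < N) (hr : r < N) {t : ℝ} (ht0 : 0 ≤ t) (ht1 : t < 1) :
    HasSum (fun n : ℕ => if n % N = r then t ^ n else 0) (t ^ r / (1 - t ^ N)) := by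
  have hinj : Function.Injective (fun k : ℕ => N * k + r) := by
    intro x y hxy
    exact Nat.eq_of_mul_eq_mul_left hN (Nat.add_right_cancel hxy)
  have hgeom : HasSum (fun k : ℕ => t ^ r * (t ^ N) ^ k) (t ^ r * (1 - t ^ N)⁻¹) :=
    (hasSum_geometric_of_lt_one (pow_nonneg ht0 N) (pow_lt_one₀ ht0 ht1 hN.ne')).mul_left _
  rw [div_eq_mul_inv]
  refine (hinj.hasSum_iff ?_).mp ?_
  · intro n hn
    rw [if_neg]
    intro hmod
    apply hn
    refine ⟨n / N, ?_⟩
    have h := Nat.div_add_mod n N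
    show N * (n / N) + r = n
    omega
  · refine hgeom.congr_fun fun k => ?_
    have h1 : (N * k + r) % N = r := by rw [Nat.mul_add_mod, Nat.mod_eq_of_lt hr]
    simp only [Function.comp_apply]
    rw [if_pos h1, ← pow_mul, ← pow_add]
    congr 1
    ring

/-- Resummation of a power series with `N`-periodic coefficients (`0 ≤ t < 1`):
`Σ_n f(n) tⁿ = (Σ_{r<N} f(r) t^r)/(1 − t^N)`. [folklore] -/
theorem hasSum_periodic {N : ℕ} (hN : 0 < N) (f : ℕ → ℝ) (hf : ∀ n, f n = f (n % N)) {t : ℝ}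
    (ht0 : 0 ≤ t) (ht1 : t < 1) :
    HasSum (fun n : ℕ => t ^ n * f n) ((∑ r ∈ Finset.range N, f r * t ^ r) / (1 - t ^ N)) := by
  have h : HasSum (fun n : ℕ => ∑ r ∈ Finset.range N, f r * (if n % N = r then t ^ n else 0))
      (∑ r ∈ Finset.range N, f r * (t ^ r / (1 - t ^ N))) :=
    hasSum_sum fun r hr => (hasSum_ite_mod hN (Finset.mem_range.mp hr) ht0 ht1).mul_left (f r)
  have e : (∑ r ∈ Finset.range N, f r * t ^ r) / (1 - t ^ N) =
      ∑ r ∈ Finset.range N, f r * (t ^ r / (1 - t ^ N)) := by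
    rw [Finset.sum_div]
    refine Finset.sum_congr rfl fun r _ => ?_
    ring
  rw [e]
  refine h.congr_fun fun n => ?_
  rw [Finset.sum_eq_single (n % N)]
  · rw [if_pos rfl, hf n, mul_comm]
  · intro r _ hr
    rw [if_neg (Ne.symm hr), mul_zero]
  · intro h'
    exact absurd (Finset.mem_range.mpr (Nat.mod_lt n hN)) h'

/-! ### Step 2: the angle `θ = 2πa/N` -/

/-- `cos((n+1)θ)` and `sin((n+1)θ)` are `N`-periodic in `n` for `θ = 2πa/N`. [folklore] -/
theorem cos_sin_periodic (N a n : ℕ) (hN : 0 < N) :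
    Real.cos (((n : ℝ) + 1) * (2 * π * a / N)) =
        Real.cos ((((n % N : ℕ) : ℝ) + 1) * (2 * π * a / N)) ∧
      Real.sin (((n : ℝ) + 1) * (2 * π * a / N)) =
        Real.sin ((((n % N : ℕ) : ℝ) + 1) * (2 * π * a / N)) := by
  have hN' : (N : ℝ) ≠ 0 := by exact_mod_cast hN.ne'
  have h := Nat.div_add_mod n N
  set q := n / N
  set r := n % N
  have hn : (n : ℝ) = N * q + r := by exact_mod_cast h.symm
  have key : ((n : ℝ) + 1) * (2 * π * a / N) =
      ((r : ℝ) + 1) * (2 * π * a / N) + ((q * a : ℕ) : ℝ) * (2 * π) := by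
    rw [hn, Nat.cast_mul]
    field_simp
    ring
  rw [key, Real.cos_add_nat_mul_two_pi, Real.sin_add_nat_mul_two_pi]
  exact ⟨rfl, rfl⟩

/-- Reflection: for `i + j + 2 = N`, `cos((i+1)θ) = cos((j+1)θ)` and `sin((i+1)θ) = −sin((j+1)θ)`
(`(i+1)θ = 2πa − (j+1)θ`). [folklore] -/
theorem cos_sin_reflect (N a i j : ℕ) (hN : 0 < N) (h : i + j + 2 = N) :
    Real.cos (((i : ℝ) + 1) * (2 * π * a / N)) = Real.cos (((j : ℝ) + 1) * (2 * π * a / N)) ∧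
      Real.sin (((i : ℝ) + 1) * (2 * π * a / N)) =
        -Real.sin (((j : ℝ) + 1) * (2 * π * a / N)) := by
  have hN' : (N : ℝ) ≠ 0 := by exact_mod_cast hN.ne'
  have hij : (i : ℝ) + j + 2 = N := by exact_mod_cast h
  have key : ((i : ℝ) + 1) * (2 * π * a / N) = (a : ℝ) * (2 * π) - ((j : ℝ) + 1) * (2 * π * a / N) := by
    rw [← hij]
    have : (i : ℝ) + j + 2 ≠ 0 := by rw [hij]; exact hN'
    field_simp
    ring
  rw [key, Real.cos_nat_mul_two_pi_sub, Real.sin_nat_mul_two_pi_sub]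
  exact ⟨rfl, rfl⟩

/-- `sin(Nθ) = sin(2πa) = 0`, in the form `sin(((N−1)+1)θ) = 0`. [folklore] -/
theorem sin_last (N a : ℕ) (hN : 0 < N) :
    Real.sin ((((N - 1 : ℕ) : ℝ) + 1) * (2 * π * a / N)) = 0 := by
  have hN' : (N : ℝ) ≠ 0 := by exact_mod_cast hN.ne'
  have e : ((N - 1 : ℕ) : ℝ) + 1 = N := by
    norm_cast
    omega
  have key : (((N - 1 : ℕ) : ℝ) + 1) * (2 * π * a / N) = ((2 * a : ℕ) : ℝ) * π := by
    rw [e]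
    push_cast
    field_simp
  rw [key, Real.sin_nat_mul_pi]

/-- `θ = 2πa/N ∈ [0, π]` for `2a ≤ N`, hence `√(1 − cos²θ) = sin θ`. [folklore] -/
theorem sqrt_one_sub_cos_sq (N a : ℕ) (hN : 0 < N) (h2a : 2 * a ≤ N) :
    Real.sqrt (1 - Real.cos (2 * π * a / N) ^ 2) = Real.sin (2 * π * a / N) := by
  have hNpos : (0 : ℝ) < N := by exact_mod_cast hN
  have h0 : 0 ≤ 2 * π * a / N := by positivity
  have hπ : 2 * π * a / N ≤ π := by
    rw [div_le_iff₀ hNpos]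
    have : (2 * a : ℝ) ≤ N := by exact_mod_cast h2a
    nlinarith [Real.pi_pos]
  rw [← Real.sin_sq, Real.sqrt_sq (Real.sin_nonneg_of_nonneg_of_le_pi h0 hπ)]

/-! ### Step 3: the resummed Chebyshev kernels -/

/-- **Resummed generating functions at `θ = 2πa/N`** (`N ≥ 1`, `0 ≤ t < 1`):
`(cos θ − t)/(1 − 2t cos θ + t²) = (Σ_{r<N} cos((r+1)θ) t^r)/(1 − t^N)` and
`sin θ/(1 − 2t cos θ + t²) = (Σ_{r<N} sin((r+1)θ) t^r)/(1 − t^N)`. [folklore] -/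
theorem kernel_eq_sum_div (N a : ℕ) (hN : 0 < N) {t : ℝ} (ht0 : 0 ≤ t) (ht1 : t < 1) :
    (Real.cos (2 * π * a / N) - t) / (1 - 2 * Real.cos (2 * π * a / N) * t + t ^ 2) =
        (∑ r ∈ Finset.range N, Real.cos (((r : ℝ) + 1) * (2 * π * a / N)) * t ^ r) /
          (1 - t ^ N) ∧
      Real.sin (2 * π * a / N) / (1 - 2 * Real.cos (2 * π * a / N) * t + t ^ 2) =
        (∑ r ∈ Finset.range N, Real.sin (((r : ℝ) + 1) * (2 * π * a / N)) * t ^ r) /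
          (1 - t ^ N) := by
  have h := PartialFractions.hasSum_cos_sin_geom ht0 ht1 (2 * π * a / N)
  exact ⟨h.1.unique (hasSum_periodic hN (fun n => Real.cos (((n : ℝ) + 1) * (2 * π * a / N)))
      (fun n => (cos_sin_periodic N a n hN).1) ht0 ht1),
    h.2.unique (hasSum_periodic hN (fun n => Real.sin (((n : ℝ) + 1) * (2 * π * a / N)))
      (fun n => (cos_sin_periodic N a n hN).2) ht0 ht1)⟩

/-! ### Step 4: the polynomials `Σ_{r<N} g(r) X^r` -/

/-- Evaluation of `Σ_{r<N} C (g r) X^r`. [folklore] -/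
theorem eval_sumPoly (N : ℕ) (g : ℕ → ℝ) (t : ℝ) :
    Polynomial.eval t (∑ r ∈ Finset.range N, Polynomial.C (g r) * Polynomial.X ^ r) =
      ∑ r ∈ Finset.range N, g r * t ^ r := by
  rw [Polynomial.eval_finsetSum]
  simp only [Polynomial.eval_mul, Polynomial.eval_C, Polynomial.eval_pow, Polynomial.eval_X]

/-- Coefficients of `Σ_{r<N} C (g r) X^r`. [folklore] -/
theorem coeff_sumPoly (N : ℕ) (g : ℕ → ℝ) (i : ℕ) :
    (∑ r ∈ Finset.range N, Polynomial.C (g r) * Polynomial.X ^ r).coeff i =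
      if i < N then g i else 0 := by
  rw [Polynomial.finsetSum_coeff]
  simp only [Polynomial.coeff_C_mul_X_pow]
  rw [Finset.sum_ite_eq]
  exact if_congr Finset.mem_range rfl rfl

/-- `Σ_{r<N} C (g r) X^r` has degree `< N` (`N ≥ 1`). [folklore] -/
theorem natDegree_sumPoly_lt {N : ℕ} (hN : 0 < N) (g : ℕ → ℝ) :
    (∑ r ∈ Finset.range N, Polynomial.C (g r) * Polynomial.X ^ r).natDegree < N := by
  have h : (∑ r ∈ Finset.range N, Polynomial.C (g r) * Polynomial.X ^ r).natDegree ≤ N - 1 :=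
    Polynomial.natDegree_sum_le_of_forall_le _ _ fun r hr =>
      (Polynomial.natDegree_C_mul_X_pow_le _ _).trans
        (by have := Finset.mem_range.mp hr; omega)
  omega

/-- `α · (kernel) = (Σ_{r<N} α g(r) t^r)/(1 − t^N)` from `kernel = (Σ_{r<N} g(r) t^r)/(1 − t^N)`.
[folklore] -/
theorem mul_kernel_eq (N : ℕ) (g : ℕ → ℝ) (α K t : ℝ)
    (hK : K = (∑ r ∈ Finset.range N, g r * t ^ r) / (1 - t ^ N)) :
    α * K = Polynomial.eval t
      (∑ r ∈ Finset.range N, Polynomial.C (α * g r) * Polynomial.X ^ r) / (1 - t ^ N) := by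
  rw [eval_sumPoly, hK, ← mul_div_assoc, Finset.mul_sum]
  congr 1
  refine Finset.sum_congr rfl fun r _ => ?_
  ring

/-! ### Step 5: the open unit box -/

/-- The open unit box `(0,1)^w` is `ℚ`-semialgebraic (`2w` strict polynomial inequalities).
[folklore] -/
theorem isSemialgebraic_box (w : ℕ) :
    Literature.ModelTheory.ExponentialFields.IsSemialgebraic ℚ
      {x : Fin w → ℝ | ∀ i, x i ∈ Set.Ioo (0 : ℝ) 1} := by
  -- adapted from `SymReduction.isSemialgebraic_unitBox` (sibling file `…StubSymReductionKit.lean`)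
  have h : {x : Fin w → ℝ | ∀ i, x i ∈ Set.Ioo (0 : ℝ) 1} =
      ⋂ j ∈ (Finset.univ : Finset (Fin w)),
        ({x | 0 < MvPolynomial.aeval x (MvPolynomial.X j : MvPolynomial (Fin w) ℚ)} ∩
          {x | 0 < MvPolynomial.aeval x (1 - MvPolynomial.X j : MvPolynomial (Fin w) ℚ)}) := by
    ext x
    simp [sub_pos]
  rw [h]
  exact Literature.ModelTheory.ExponentialFields.IsSemialgebraic.biInter _ _ fun j _ =>
    (Literature.ModelTheory.ExponentialFields.isSemialgebraic_setOf_eval_pos _).inter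
      (Literature.ModelTheory.ExponentialFields.isSemialgebraic_setOf_eval_pos _)

/-- The product coordinate `x ↦ ∏ xᵢ` is `ℚ`-semialgebraic on the open unit box. [folklore] -/
theorem isSemialgebraicFunOn_prod (w : ℕ) :
    IsSemialgebraicFunOn ℚ {x : Fin w → ℝ | ∀ i, x i ∈ Set.Ioo (0 : ℝ) 1} (fun x => ∏ i, x i) :=
  (isSemialgebraicFunOn_aeval (isSemialgebraic_box w)
    (∏ i, MvPolynomial.X i : MvPolynomial (Fin w) ℚ)).congr fun x _ => by simp [map_prod]

/-- **Semialgebraicity of the two kernels on the box** (dimension `n + 2`): for `c = cos u`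
real algebraic, the functions `(c − P)/(1 − 2cP + P²)` and `√(1 − c²)/(1 − 2cP + P²)`,
`P = ∏ xᵢ`, are `ℚ`-semialgebraic on `(0,1)^{n+2}` (arithmetic closure, `ℚ`-definability of real
algebraic constants, and positivity of the denominator there, `PartialFractions.den_pos`).
[folklore] -/
theorem kernels_semialgebraic (n : ℕ) (u : ℝ) (hc : IsAlgebraic ℚ (Real.cos u)) :
    IsSemialgebraicFunOn ℚ {x : Fin (n + 2) → ℝ | ∀ i, x i ∈ Set.Ioo (0 : ℝ) 1}
        (fun x => (Real.cos u - ∏ i, x i) /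
          (1 - 2 * Real.cos u * (∏ i, x i) + (∏ i, x i) ^ 2)) ∧
      IsSemialgebraicFunOn ℚ {x : Fin (n + 2) → ℝ | ∀ i, x i ∈ Set.Ioo (0 : ℝ) 1}
        (fun x => Real.sqrt (1 - Real.cos u ^ 2) /
          (1 - 2 * Real.cos u * (∏ i, x i) + (∏ i, x i) ^ 2)) := by
  have hB := isSemialgebraic_box (n + 2)
  have hP := isSemialgebraicFunOn_prod (n + 2)
  have hcst : IsSemialgebraicFunOn ℚ {x : Fin (n + 2) → ℝ | ∀ i, x i ∈ Set.Ioo (0 : ℝ) 1}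
      (fun _ => Real.cos u) := isSemialgebraicFunOn_const_of_isAlgebraic hB hc
  have h1 : IsSemialgebraicFunOn ℚ {x : Fin (n + 2) → ℝ | ∀ i, x i ∈ Set.Ioo (0 : ℝ) 1}
      (fun _ => (1 : ℝ)) := (isSemialgebraicFunOn_const_natCast hB 1).congr fun _ _ => Nat.cast_one
  have h2 : IsSemialgebraicFunOn ℚ {x : Fin (n + 2) → ℝ | ∀ i, x i ∈ Set.Ioo (0 : ℝ) 1}
      (fun _ => (2 : ℝ)) := isSemialgebraicFunOn_const_ofNat hB 2
  have hden : IsSemialgebraicFunOn ℚ {x : Fin (n + 2) → ℝ | ∀ i, x i ∈ Set.Ioo (0 : ℝ) 1}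
      (fun x => 1 - 2 * Real.cos u * (∏ i, x i) + (∏ i, x i) ^ 2) :=
    (h1.fun_sub ((h2.fun_mul hcst).fun_mul hP)).fun_add (hP.fun_pow 2)
  have hden0 : ∀ x ∈ {x : Fin (n + 2) → ℝ | ∀ i, x i ∈ Set.Ioo (0 : ℝ) 1},
      1 - 2 * Real.cos u * (∏ i, x i) + (∏ i, x i) ^ 2 ≠ 0 := fun x hx =>
    have hu := BoxIntegral.prod_mem_Ioo (by omega) hx
    (PartialFractions.den_pos hu.1.le hu.2 u).ne'
  exact ⟨(hcst.fun_sub hP).div hden hden0, ((h1.fun_sub (hcst.fun_pow 2)).fun_sqrt).div hden hden0⟩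

/-- **Integrability of the resummed kernels on the box** (dimension `n + 2 ≥ 2`, `N ≥ 1`): a
function agreeing on `(0,1)^{n+2}` with `Σ_{r<N} g(r) P^r/(1 − P^N)`, `P = ∏ xᵢ`, is integrable
there (`BoxIntegral.integrableOn_box_prod_pow_div_one_sub_prod_pow`). [folklore] -/
theorem integrableOn_of_eq_sum (n : ℕ) {N : ℕ} (hN : 0 < N) (g : ℕ → ℝ)
    (K : (Fin (n + 2) → ℝ) → ℝ)
    (hK : ∀ x ∈ {x : Fin (n + 2) → ℝ | ∀ i, x i ∈ Set.Ioo (0 : ℝ) 1},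
      K x = (∑ r ∈ Finset.range N, g r * (∏ i, x i) ^ r) / (1 - (∏ i, x i) ^ N)) :
    IntegrableOn K {x : Fin (n + 2) → ℝ | ∀ i, x i ∈ Set.Ioo (0 : ℝ) 1} := by
  have hsum : IntegrableOn (fun x : Fin (n + 2) → ℝ => ∑ r ∈ Finset.range N,
      g r * ((∏ j, x j) ^ r / (1 - (∏ j, x j) ^ N)))
      {x | ∀ i, x i ∈ Set.Ioo (0 : ℝ) 1} volume :=
    integrable_finsetSum _ fun r _ =>
      (BoxIntegral.integrableOn_box_prod_pow_div_one_sub_prod_pow (by omega) hN r).const_mul _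
  refine hsum.congr_fun (fun x hx => ?_) (Beukers.measurableSet_cube (n + 2))
  rw [hK x hx, Finset.sum_div]
  refine Finset.sum_congr rfl fun r _ => ?_
  ring

end TowerReductionKernelPoly

open TowerReductionKernelPoly in
/-- **Cyclotomic Chebyshev kernels are level-`N` sector integrands.** For `N ≥ 1`,
`0 ≤ 2a ≤ N`, `θ = 2πa/N` and a real algebraic `α`: the `T`-kernel
`α(cos θ − t)/(1 − 2t cos θ + t²)` and the `U`-kernel `α√(1 − cos²θ)/(1 − 2t cos θ + t²)` equal
`R(t)/(1 − t^N)` on `[0,1)` for the explicit polynomials `R_T = α Σ_{r<N} cos((r+1)θ) X^r`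
(symmetric) and `R_U = α Σ_{r<N} sin((r+1)θ) X^r` (antisymmetric, top coefficient
`α sin(2πa) = 0`), of degree `< N` with real-algebraic coefficients; and both kernels composed with
`t = ∏ xᵢ` are `ℚ`-semialgebraic and integrable on the open unit box of every dimension `n + 2`.
[folklore] -/
theorem towerReduction_kernelPoly : ∀ (N a : ℕ) (α : ℝ), 0 < N → 2 * a ≤ N → IsAlgebraic ℚ α → (∃ R : Polynomial ℝ, (∀ i, IsAlgebraic ℚ (R.coeff i)) ∧ R.natDegree < N ∧ (∀ i j : ℕ, i + j + 2 = N → R.coeff i = R.coeff j) ∧ ∀ t : ℝ, 0 ≤ t → t < 1 → α * ((Real.cos (2 * Real.pi * a / N) - t) / (1 - 2 * Real.cos (2 * Real.pi * a / N) * t + t ^ 2)) = Polynomial.eval t R / (1 - t ^ N)) ∧ (∃ R : Polynomial ℝ, (∀ i, IsAlgebraic ℚ (R.coeff i)) ∧ R.natDegree < N ∧ (∀ i j : ℕ, i + j + 2 = N → R.coeff i = - R.coeff j) ∧ R.coeff (N - 1) = 0 ∧ ∀ t : ℝ, 0 ≤ t → t < 1 → α * (Real.sqrt (1 - Real.cos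 (2 * Real.pi * a / N) ^ 2) / (1 - 2 * Real.cos (2 * Real.pi * a / N) * t + t ^ 2)) = Polynomial.eval t R / (1 - t ^ N)) ∧ (∀ n : ℕ, IsSemialgebraicFunOn ℚ {x : Fin (n + 2) → ℝ | ∀ i, x i ∈ Set.Ioo (0:ℝ) 1} (fun x => (Real.cos (2 * Real.pi * a / N) - ∏ i, x i) / (1 - 2 * Real.cos (2 * Real.pi * a / N) * (∏ i, x i) + (∏ i, x i) ^ 2)) ∧ MeasureTheory.IntegrableOn (fun x : Fin (n + 2) → ℝ => (Real.cos (2 * Real.pi * a / N) - ∏ i, x i) / (1 - 2 * Real.cos (2 * Real.pi * a / N) * (∏ i, x i) + (∏ i, x i) ^ 2)) {x | ∀ i, x i ∈ Set.Ioo (0:ℝ) 1} ∧ IsSemialgebraicFunOn ℚ {x : Fin (n + 2) → ℝ | ∀ i, x i ∈ Set.Ioo (0:ℝ) 1} (fun x => Real.sqrt (1 - Real.cos (2 * Real.pi * a / N) ^ 2) / (1 - 2 * Real.cos (2 * Real.pi * a / N) * (∏ i, x i) + (∏ i, x i) ^ 2)) ∧ MeasureTheory.IntegrableOn (fun x : Fin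 (n + 2) → ℝ => Real.sqrt (1 - Real.cos (2 * Real.pi * a / N) ^ 2) / (1 - 2 * Real.cos (2 * Real.pi * a / N) * (∏ i, x i) + (∏ i, x i) ^ 2)) {x | ∀ i, x i ∈ Set.Ioo (0:ℝ) 1}) := by
  intro N a α hN h2a hα
  -- algebraicity of the Fourier coefficients
  have hcos : ∀ i : ℕ, IsAlgebraic ℚ (Real.cos (((i : ℝ) + 1) * (2 * π * a / N))) := fun i => by
    have h := PairValueAlgebraic.isAlgebraic_cos_two_pi_mul (i + 1) a N
    convert h using 2
    push_cast
    ring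
  have hsin : ∀ i : ℕ, IsAlgebraic ℚ (Real.sin (((i : ℝ) + 1) * (2 * π * a / N))) := fun i => by
    have h := PairValueAlgebraic.isAlgebraic_sin_two_pi_mul (i + 1) a N
    convert h using 2
    push_cast
    ring
  have hc1 : IsAlgebraic ℚ (Real.cos (2 * π * a / N)) := by
    have h := PairValueAlgebraic.isAlgebraic_cos_two_pi_mul 1 a N
    convert h using 2
    push_cast
    ring
  have hsq := sqrt_one_sub_cos_sq N a hN h2a
  refine ⟨⟨∑ r ∈ Finset.range N,
      Polynomial.C (α * Real.cos (((r : ℝ) + 1) * (2 * π * a / N))) * Polynomial.X ^ r,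
      ?_, natDegree_sumPoly_lt hN _, ?_, ?_⟩,
    ⟨∑ r ∈ Finset.range N,
      Polynomial.C (α * Real.sin (((r : ℝ) + 1) * (2 * π * a / N))) * Polynomial.X ^ r,
      ?_, natDegree_sumPoly_lt hN _, ?_, ?_, ?_⟩, fun n => ⟨?_, ?_, ?_, ?_⟩⟩
  · -- `R_T`: algebraic coefficients
    intro i
    rw [coeff_sumPoly]
    split_ifs
    · exact hα.mul (hcos i)
    · exact isAlgebraic_zero
  · -- `R_T`: symmetry
    intro i j hij
    rw [coeff_sumPoly, coeff_sumPoly, if_pos (by omega), if_pos (by omega),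
      (cos_sin_reflect N a i j hN hij).1]
  · -- `R_T`: the identity on `[0,1)`
    intro t ht0 ht1
    exact mul_kernel_eq N _ α _ t (kernel_eq_sum_div N a hN ht0 ht1).1
  · -- `R_U`: algebraic coefficients
    intro i
    rw [coeff_sumPoly]
    split_ifs
    · exact hα.mul (hsin i)
    · exact isAlgebraic_zero
  · -- `R_U`: antisymmetry
    intro i j hij
    rw [coeff_sumPoly, coeff_sumPoly, if_pos (by omega), if_pos (by omega),
      (cos_sin_reflect N a i j hN hij).2, mul_neg]
  · -- `R_U`: top coefficient
    rw [coeff_sumPoly, if_pos (by omega), sin_last N a hN, mul_zero]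
  · -- `R_U`: the identity on `[0,1)`
    intro t ht0 ht1
    rw [hsq]
    exact mul_kernel_eq N _ α _ t (kernel_eq_sum_div N a hN ht0 ht1).2
  · exact (kernels_semialgebraic n (2 * π * a / N) hc1).1
  · refine integrableOn_of_eq_sum n hN (fun r => Real.cos (((r : ℝ) + 1) * (2 * π * a / N))) _
      fun x hx => ?_
    have hu := BoxIntegral.prod_mem_Ioo (by omega) hx
    exact (kernel_eq_sum_div N a hN hu.1.le hu.2).1
  · exact (kernels_semialgebraic n (2 * π * a / N) hc1).2
  · refine integrableOn_of_eq_sum n hN (fun r => Real.sin (((r : ℝ) + 1) * (2 * π * a / N))) _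
      fun x hx => ?_
    have hu := BoxIntegral.prod_mem_Ioo (by omega) hx
    simp only [hsq]
    exact (kernel_eq_sum_div N a hN hu.1.le hu.2).2

end Summit.KontsevichZagierPeriods.Theorems.HurwitzMicroSectorsHurwitzSectorComplement

end
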